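import Mathlib.Computability.Language
import Literature.Computability.Cryptography.QuantumTuringMachine
import Literature.Computability.Cryptography.QuantumCircuit
import Literature.Computability.Cryptography.ClassBQP
import Literature.Computability.Complexity.Classes
import HarnessLib

-- provenance: harness21/H21/H21/Statements/QuantumAdvantage/QuantumTuring.lean @ a936f47 (interim HEAD d8f2665); M5 mechanical rewrite
/-!
# Quantum advantage: `BQP` via quantum Turing machines (family quantum-advantage, S03–S05)

Target statements of the family `quantum-advantage` concerning Bernstein–Vazirani quantum
Turing machines (outline CryptoQuantFine §3, `QuantumAdvantage/QuantumTuring`):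

* **S03** `mem_BQPQTM_iff` — the definition of `BQP` via well-formed QTMs with polynomial-time
  computable amplitudes, unfolded (definition home of the notion; `Iff.rfl`);
* **S04** `BQPQTM_eq_BQP` — polynomial-time QTMs and poly-time uniform quantum circuit families
  decide the same class of languages (Yao 1993; Nishimura–Ozawa 2002);
* **S05** `BQPQTMWith_adhAmplitudes` — restricting the amplitudes to the finite set
  `{0, ±3/5, ±4/5, ±1}` does not change `BQP` (Adleman–DeMarrais–Huang 1997).

## Sources

* E. Bernstein, U. Vazirani, *Quantum complexity theory*, SIAM J. Comput. 26 (1997) 1411–1473,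
  Def. 3.2.2–3.2.3, §6, §8.
* A. C.-C. Yao, *Quantum circuit complexity*, Proc. 34th FOCS (1993) 352–361.
* H. Nishimura, M. Ozawa, *Computational complexity of uniform quantum circuit families and
  quantum Turing machines*, Theoret. Comput. Sci. 276 (2002) 147–181 = arXiv:quant-ph/9906095,
  Thm. 5.2 (`BQP = BUPQC`; theorem numbering of the arXiv text, the one read), with Thm. 4.3
  (circuits simulate QTMs, after Yao) and Lemma 5.1 (QTMs simulate uniform circuit families);
  Thm. 5.7 there is the variant for arbitrary complex amplitudes and semi-uniform families.
* L. Adleman, J. DeMarrais, M.-D. Huang, *Quantum computability*, SIAM J. Comput. 26 (1997)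
  1524–1540, Def. 2.1 (`BQP_T`, acceptance after exactly `f(|x|)` steps), Thm. 3.1 and Cor. 3.2
  (`BQP_BV = BQP_ℚ = BQP_poly(1/ε)`), Thm. 3.3(e) (the angle with `cos θ = 3/5`, `sin θ = 4/5`),
  pp. 1526–1527.

## Mathlib / H21 reuse

Mathlib has `Language` but no quantum Turing machines or quantum complexity classes (searched
`QTM`, `BQP`, `Quantum` under `Computability/`). All notions come from the H21 prelude:
`QTM`, `QTM.IsWellFormed`, `QTM.amplitudes`, `QTM.acceptProbAt`, `BQPQTMWith`, `BQPQTM`,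
`polyTimeComputableComplex`, `adhAmplitudes` (Q8 `QuantumTuringMachine`) and the circuit class
`BQP = BQPOver cliffordT` (Q3 `ClassBQP`). This file introduces no new definitions.

## Design choices

* As in Q8, acceptance of a QTM is read off by observing the control state after *exactly*
  `p(|x|)` steps for a polynomial `p` (Bernstein–Vazirani's stationary normal form / fixed-time
  measurement simplification, BV 1997 §1 and §8), rather than via halting configurations; this
  is recorded in the docstring of S03.
* S04 compares `BQPQTM` with the Clifford+T circuit class `BQP` of Q3; the circuit side of
  Yao / Nishimura–Ozawa uses poly-time uniform families with finitely many algebraic gates,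
  which is what `BQP` fixes.
* Model caveat (inherited from Q8, affects S03–S05 alike; details and a proved two-state example
  in `QuantumTuringProofs.lean`, sections "Model caveat" and "The model caveat, sharpened"): Q8's
  configurations `QTM.Cfg = (state, Turing.Tape)` are head-relative, i.e. Bernstein–Vazirani's
  configurations (tape cells indexed by `ℤ`, BV 1997 Def. 3.1–3.2) *modulo translation*.
  `QTM.IsWellFormed` still agrees with BV well-formedness (Def. 3.3 / Thm. 5.3) once the tape
  alphabet has a non-blank symbol (proved: `QTM.pIsWellFormed_iff_isWellFormed`,
  `Cryptography/QuantumTuringMachinePositionedFaithful.lean`), but `QTM.acceptProbAt` adds the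
  amplitudes of translates, so it is BV's acceptance probability plus interference terms between
  a run and its own translates (already `576/625` versus BV's `288/625` for a unidirectional
  two-state machine with amplitudes in `adhAmplitudes` on the empty input at time `2`; both
  numbers proved in `QuantumTuringProofs.lean`, section `RotationWalk`). The printed proofs of
  S04/S05 establish the identities for BV's model; for the tree's model the hypothesis side (an
  arbitrary well-formed machine) would have to be simulated in the translation-quotient
  semantics, which no source does. Bernstein–Vazirani's model itself is vendored, on top of Q8
  and without changing it, as the *positioned* model of
  `Cryptography/QuantumTuringMachinePositioned.lean` (`QTM.PCfg M = M.Cfg × ℤ`, `QTM.pevolve`,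
  `QTM.PIsWellFormed`, `QTM.pacceptProbAt`, classes `BQPQTMPosWith S`, `BQPQTMPos`; faithfulness
  `PCfg M ≃ Q × Σ^# × ℤ` in `…PositionedFaithful.lean`), in which the printed statements read
  `BQPQTMPos = BQP` (S04; glue `BQPQTMPos_eq_BQP_of`, and the bridge `BQPQTM_eq_BQP_of_pos` showing
  that the printed stationary construction also yields the inclusion `BQP ⊆ BQPQTM` of the tree's
  S04, in `QuantumTuringProofs.lean`) and `BQPQTMPosWith adhAmplitudes = BQPQTMPos` (S05). The
  in-place repair of Q8 (an absolute head position `pos : ℤ` in `QTM.Cfg`, updated by `evolve`)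
  would be isomorphic to the positioned model; until the operator re-points S03–S05 or repairs
  Q8, S04 and S05 should be read as "the printed theorem, transported to Q8's conventions,
  repair pending".
* Status of S04 (D-0026 review-split, 2026-08-15; details in the docstring of `BQPQTM_eq_BQP`).
  The sentence above, "for the tree's model the hypothesis side (an arbitrary well-formed
  machine) would have to be simulated in the translation-quotient semantics, which no source
  does", is superseded for S04: that simulation now EXISTS in the tree — the head-centred
  simulation `QTM.hcFamily` of an arbitrary well-formed machine over its own finite gate set
  (`Cryptography/QuantumTuringMachineHeadCentred*.lean`, `…CodedGates.lean`,
  `…CircuitLayout.lean`, `…CircuitSemantics.lean`, `…CircuitUniform.lean`), whence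
  `BQPQTM ⊆ BQP` unconditionally (`BQPQTM_subset_BQP`, `QuantumTuringADHGateSet.lean`, through
  `BQPQTM_subset_BQP_of_gateSetIndependence`, `QuantumTuringCircuitDirection.lean`, and gate-set
  independence `BQPOver_eq_BQP_holds`, `EffectiveCompilation.lean`). The remaining half of S04,
  `BQP ⊆ BQPQTM`, is a CONSTRUCTION (Nishimura–Ozawa's Lemma 5.1, a machine executing a uniform
  circuit family) whose head trajectory does not depend on the computation path, so it is
  insensitive to the model caveat (`QTM.acceptProbAt_eq_pacceptProbAt`,
  `Cryptography/QuantumTuringMachinePositionedOblivious.lean`; bridge `BQP_subset_BQPQTM_of_pos`).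
  For S05 the same theorem removes the caveat through the circuit route of
  `QuantumTuringADHGateSet.lean` (`BQPQTM_subset_BQPOver_adhGateSet`,
  `BQPQTMWith_adhAmplitudes_of_exec`): what both statements still need is a machine EXECUTING
  a uniform circuit family, over Clifford+`T` for S04 and over the ADH gate set for S05.
-/

namespace Literature.Computability.QuantumComplexity

open Cryptography Complexity

/-- **quantum-advantage.S03** (BQP via quantum Turing machines; Bernstein–Vazirani 1997,
Def. 3.2.2–3.2.3 and §8). A language `L` is in `BQPQTM` iff there are a well-formed quantum
Turing machine `M` whose transition amplitudes are polynomial-time computable complex numbers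
and a polynomial `p` such that, measuring the control state of `M` after exactly `p(|x|)` steps
on input `x`, the accepting state is observed with probability `≥ 2/3` when `x ∈ L` and
`≤ 1/3` when `x ∉ L`. (Fixed-time measurement replaces BV's halting convention; by the
stationary normal form of BV 1997 §8 this does not change the class.) Holds by definition. [cite: BernsteinVazirani1997, Def. 3.2.2–3.2.3 and §8] -/
theorem mem_BQPQTM_iff (L : Language Bool) :
    L ∈ BQPQTM ↔ ∃ (M : QTM) (p : Polynomial ℕ), M.IsWellFormed ∧
      M.amplitudes ⊆ polyTimeComputableComplex ∧
      ∀ x : List Bool, (x ∈ L → (2 / 3 : ℝ) ≤ M.acceptProbAt x (p.eval x.length)) ∧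
        (x ∉ L → M.acceptProbAt x (p.eval x.length) ≤ (1 / 3 : ℝ)) :=
  Iff.rfl

/-- **quantum-advantage.S04** (QTMs versus uniform circuit families; Yao, FOCS 1993;
Nishimura–Ozawa, TCS 276 (2002) = arXiv:quant-ph/9906095, Thm. 5.2 `BQP = BUPQC`, arXiv
numbering). Polynomial-time well-formed quantum Turing machines with polynomial-time computable
amplitudes and polynomial-time uniform families of quantum circuits over Clifford+T decide, with
bounded error, the same class of languages: `BQPQTM = BQP`. Nishimura–Ozawa's uniform families
are over rotations by polynomial-time computable angles and `CNOT` (`𝒢_PC`); the passage to the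
finite gate set Clifford+T is the Solovay–Kitaev theorem (Nielsen–Chuang 2010, App. 3,
Thm. A3.1), and measuring the control state at an exact polynomial time replaces their halting
convention (Remark 2 after Thm. 5.2; Bernstein–Vazirani 1997, §8). The reduction of this fact to
the two simulation theorems of the printed proof is `BQPQTM_eq_BQP_of`
(`QuantumTuringProofs.lean`), where a caveat on the tree's head-centred QTM configurations is
also recorded: as stated here (`BQPQTM`, Q8's translation-quotient semantics) the equality is NOT
literally the printed theorem — Nishimura–Ozawa's Thm. 5.2 concerns Bernstein–Vazirani's
configurations `(q, T, ξ)` with absolute head position, i.e. the class `BQPQTMPos` of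
`Cryptography/QuantumTuringMachinePositioned.lean`, for which the faithful statement is
`BQPQTMPos = BQP` (glue `BQPQTMPos_eq_BQP_of`; the printed Lemma 5.1 construction, being
stationary, also gives `BQP ⊆ BQPQTM` here, `BQPQTM_eq_BQP_of_pos`, while the inclusion
`BQPQTM ⊆ BQP` for an arbitrary machine in the quotient semantics is not covered by any source;
see the module docstring, "Model caveat").

Review record (D-0026 review-split of 2026-08-15). This declaration is the original family
statement S04 (provenance H21 `Statements/QuantumAdvantage/QuantumTuring.lean`), not a
decomposition child; verdict: not mis-stated, not open, PROVABLE INLINE — no split, no new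
named fact. (i) The parenthetical caveat above is superseded: `BQPQTM ⊆ BQP` is a theorem of
the tree, in the quotient semantics and unconditionally — `BQPQTM_subset_BQP`
(`QuantumTuringADHGateSet.lean`) = `BQPQTM_subset_BQP_of_gateSetIndependence`
(`QuantumTuringCircuitDirection.lean`: every `BQPQTM` language lies in `BQPOver 𝒢_M` for the
machine's own finite gate set, by the head-centred simulation `QTM.hcFamily`,
`Cryptography/QuantumTuringMachineHeadCentred*.lean` ff., Nishimura–Ozawa Thm. 4.3 after
Yao 1993) fed with `BQPOver_eq_BQP_holds` (`EffectiveCompilation.lean`, the effective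
Solovay–Kitaev theorem). (ii) What remains is exactly `hNO : BQP ⊆ BQPQTM`, after which
`BQPQTM_eq_BQP_holds := Set.Subset.antisymm BQPQTM_subset_BQP hNO` (equivalently
`BQPQTM_eq_BQP_of_gateSetIndependence BQPOver_eq_BQP_holds hNO`). Its source is Nishimura–Ozawa
2002, Lemma 5.1 (arXiv numbering, p. 17: "for any `𝒢_R`-uniform QCF `𝒦` there exist a
polynomial `p` and an SNQTM `M` which simulates `𝒦` in time `p(s(n))`"; proof: write `1ⁿ`,
compute the code `c_r(K_n)` by a reversible simulation of the uniformity DTM, then carry out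
the listed gates one by one on the data track, each gate by the completion lemma, Lemma 3.1)
and the second half of the proof of Thm. 5.2 (pp. 18–19), specialised to Clifford+`T`, whose
gate entries `0, ±1, ±1/√2, i, e^{iπ/4}` lie in `C̃` (`cliffordT_polyTimeEntries`,
`Cryptography/CliffordTPolyTimeEntries.lean`). SIZE XL (comparable to the `⊆` development), but
no theory is missing — the Bernstein–Vazirani toolkit invoked by the printed proof
(synchronisation theorem, dovetailing/branching/looping lemmas) is NOT needed in the tree's
fixed-time setting, because garbage may be kept and no exact synchronisation is required:
(iii) Plan (one machine `Exec F` per uniform oracle-free family `F`, proved in the tree model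
directly). The machine is unidirectional; its local matrix on `Q × Γ` is a permutation (all
classical phases, designed as a partial injection on the (state, symbol) pairs that occur —
copying a scanned symbol into the state is injective, forgetting is done only by un-copying
against a cell that still holds the value or by writing a log symbol on a blank cell, every
mode switch is triggered by a marker that stays on the tape — and completed to a bijection by
`Equiv.extendSubtype`, the completion lemma) `⊕` the `2 × 2` gate blocks on the data qubit of
the scanned cell (`CNOT` variants are permutations), so `QTM.isWellFormed_of_unidirectional`
(`Cryptography/QuantumTuringMachineWellFormed.lean`) certifies well-formedness and
`QTM.evolve_single` (a per-configuration form of `QTM.evolve_single_of_deterministic` on the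
classical pairs) computes the run. Phases: (A0) one
sweep marks the unary word `1^{|x|}` on the input-register track (top-first, top at cell `0`;
this is `unaryEncodeNat |x|`), plants the register-bottom markers and a HOME sentinel left of
the input; `x` stays on the data track as the first `n` qubits. (A) A reversible interpreter
for flat binary stack programs (`AProg Bool (Fin K)` of `Complexity/SymbolPrograms.lean`:
`push k a` / `pop k j` / `goto j`; program counter in the control state; register `k` on track
`k`, top-first with the top at the left; per instruction one seek from HOME to the first
non-blank cell of track `k` and back, then the log symbol `(pc, popped bit)` is written on the
HOME cell and HOME re-planted one cell to the left, which makes every macro-step injective;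
no counters, no arithmetic, garbage kept) runs the program given by
`TM2Flat.exists_aprogFin_of_outputsWithin` (`Complexity/TM2ToStackProgram.lean`) for the
polynomial-time function `1ⁿ ↦ prog(F, n)`, the uniformity machine of `F` composed
(`PolyTimeComputable.comp_holds`, `Complexity/TimeBoundsProofs.lean`) with a re-serialisation of
`sigmaEncode ⟨n, m, C_n⟩` into an opcode stream chosen for the executor — cursor reset, unary
cursor advance, ancilla initialisation, `H`, `S`, `T`, and pick / controlled-`X` / drop for
`CNOT` — so Nishimura–Ozawa's binary wire indices `⟨h, i, j⟩` become unary cursor moves (a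
change of code format inside `FP`, not of the argument); it halts with the clean output
register holding `prog(F, n)`. (B) The executor keeps a program cursor and a data cursor:
copy the opcode at the program cursor into the state, walk to the data cursor, apply (the
only non-classical local columns; for `CNOT` at most one qubit is carried in the control
state and returned to its `hole` cell), walk back, un-copy the opcode against its cell,
advance the program cursor; the head trajectory depends on `n` alone (head-oblivious), so
distinct computational-basis contents of the data track are distinct configurations also
modulo translation and, after `k` opcodes, `stateAt` is the injective linear encoding of the
register state after the first `k` gates (as `enc_injective_of_inWindow`,
`steps_mulVec_E_pstateAt` in `QTMCircuitLayout.lean` / `QTMCircuitStep.lean`, run backwards).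
(C) Read the qubit of wire `0` into the control state (`accept` / a rejecting state) and idle
to the right, flagging each scanned symbol with a trail mark (entering `accept` writes an
unflagged symbol, idling a flagged one, so the table stays injective; an accepting state
absorbing on ALL symbols cannot be entered in a unidirectional well-formed machine — its `|Γ|`
columns exhaust the `accept` rows —, so the persistence lemma `QTM.acceptProbAt_eq_of_absorbing`
is to be used in the configuration-level form "control state in `{accept, reject}` and no
trail mark at or right of the head", proved by the same support tracing,
`QTM.forall_mem_support_evolve`); the observation polynomial of `BQPQTM` is any polynomial
dominating the total running time, a function of `n` alone, and at that time
`acceptProbAt x (p n) = F.acceptProbOn 0 x`. Built generically over a finite gate set with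
prescribed local unitaries, the same executor (ADH gate table, one realification bit) is the
hypothesis `hExec` of S05 (`BQPQTMWith_adhAmplitudes_of_exec`, `QuantumTuringADHGateSet.lean`).
[cite: NishimuraOzawa2002, Thm. 5.2] -/
def BQPQTM_eq_BQP : Prop :=
  BQPQTM = BQP

/-- **quantum-advantage.S05** (Adleman–DeMarrais–Huang, SIAM J. Comput. 26 (1997), Thm. 3.1
and Cor. 3.2, `BQP_BV = BQP_ℚ = BQP_Q̄ = BQP_poly(1/ε)`, via Thm. 3.3(e): Bernstein–Vazirani
machines are simulated with polynomial slowdown by machines of `QTM_θ`, `cos θ = 3/5`,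
`sin θ = 4/5`, whose local matrices are block diagonal with blocks `1`, `-1` and the rotation by
`θ`, p. 1526; their `BQP_T`, Def. 2.1, measures after exactly `f(|x|)` steps, as `BQPQTMWith`
does). Restricting the transition amplitudes of quantum Turing machines to the finite rational set
`{0, ±3/5, ±4/5, ±1}` (`adhAmplitudes`) does not change `BQP`:
`BQPQTMWith adhAmplitudes = BQPQTM`. The inclusion `⊆` is `BQPQTMWith_mono` applied to
`adhAmplitudes_subset_polyTimeComputableComplex_holds` (proved,
`Cryptography/QuantumTuringMachineProofs.lean`); the tree's `BQPQTM` uses Bernstein–Vazirani's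
amplitude class `C̃` (BV 1997, Def. 3.2: real and imaginary parts computable to within `2⁻ⁿ` in
time polynomial in `n`), which lies between `ℚ` and ADH's `poly(1/ε)` class, so Cor. 3.2
sandwiches it.

Review record (D-0026 review of 2026-08-15; this declaration is the original family statement
S05, not a decomposition child — p26385 only resolved its cite). SIZE XL: the inclusion `⊇`
is, as printed, the composite of (1) Bernstein–Vazirani 1997, Lemma 5.5 and Lemma 5.7
(unidirection and completion), (2) BV 1997, Thm. 7.1 (the universal machine of `QTM_R`,
`R = 2π ∑ 2^{-2^i}`, simulating any well-formed QTM for `T` steps with accuracy `ε` and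
slowdown polynomial in `T` and `1/ε`), assembled from Thm. 6.7 (decomposition of the local
unitary into near-trivial rotations and phase shifts, polynomial in `d` and `log 1/ε`),
Lemma 6.8, Lemma 6.10 and Thm. 6.11 (a single QTM carrying them out with the angle `R`),
(3) ADH 1997, proof of Thm. 3.3 (pp. 1528–1530): each `R`-rotation is
replaced by `a` rotations by `θ`, `a < f(1/δ)` polynomial by Lemma 3.5, which needs `θ/2π`
non-Liouville — for `cos θ = 3/5` this is Lemma 3.6 / Thm. 3.7 (Feldman's lower bound for
linear forms in two logarithms; an alternative not in the source is Solovay–Kitaev in `SO(3)`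
with `θ`-rotations in two coordinate planes, cf. `SolovayKitaev/`), together with the
perturbation bound `‖Û^t φ - U^t φ‖ < ε` from the per-step bound `ε/(2t)` (pp. 1529–1530,
elementary), and (4) BV 1997, §4 (Thm. 4.3, synchronisation; Lemmas 4.4–4.13, dovetailing, branching,
reversal, looping) to meet the FIXED measuring time of `BQPQTMWith`, plus error amplification to restore the thresholds
`2/3, 1/3` after an `ε`-accurate simulation. None of (1), (2), (4) exists in the tree as a QTM
programming toolkit.

Status (2026-08-15, provefact seats 0/1; everything named below is PROVED, no new facts).
HYPOTHESIS SIDE IN THE QUOTIENT SEMANTICS — settled: the head-centred simulation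
(`Cryptography/QuantumTuringMachineHeadCentred*.lean`, Nishimura–Ozawa 2002 Thm. 4.3 with BV 1997
Lemma 5.5: the register pins the head at cell `0`, so Q8's translation classes ARE its basis and
translates are merged coherently) and gate-set independence `BQPOver_eq_BQP_holds`
(`EffectiveCompilation.lean`, the effective Solovay–Kitaev theorem) make `BQPQTM ⊆ BQP` a theorem
of the tree (`BQPQTM_subset_BQP`, `QuantumTuringADHGateSet.lean`); the earlier remark of this
docstring that no strategy was known for an arbitrary machine in the quotient semantics is
obsolete. ROUTE B (circuits, seat 1): the gate set
`adhGateSet = {R_θ, R_θ⁻¹, P_θ = diag(1, (3+4i)/5), P_θ⁻¹, CNOT}` is unitary, inverse-closed, has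
rational complex entries and is placement-universal — `⟨R_θ, P_θ⟩` is dense in `U(2)` modulo phase
by plain irrationality of `θ/2π` (`irrational_adhAngle_div_two_pi`, ADH's step (e) ⇒ (d) ⇒ (c),
p. 1530) and the two-tori lemma, then Barenco et al. 1995 — so `BQPOver adhGateSet = BQP`
(`BQPOver_adhGateSet_eq_BQP`; two NON-COMMUTING rotations and Solovay–Kitaev replace Lemma 3.5 and
Feldman's non-Liouville bound of the printed single-rotation argument); realification with one
shared flag wire (`CircuitRealification.lean`, the standard real-amplitude reduction quoted by
ADH §2, p. 1525; acceptance probabilities and uniformity unchanged) and dropping the idle flag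
wire of the real gates give the REAL gate set
`adhRealGateSet = {R_θ, R_θ⁻¹, Λ(R_θ), Λ(R_θ⁻¹), CNOT}` (gates on `≤ 2` wires, every entry in
`adhAmplitudes`) with `BQP ⊆ BQPOver adhRealGateSet` (`QuantumTuringADHRealGateSet.lean`). Hence
THE MISSING INCLUSION `BQPQTM ⊆ BQPQTMWith adhAmplitudes` FOLLOWS FROM ONE MACHINE-LEVEL STATEMENT,
the circuit executor `BQPOver adhRealGateSet ⊆ BQPQTMWith adhAmplitudes`
(`BQPQTM_subset_BQPQTMWith_adhAmplitudes_of_realExec`; complex form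
`BQPQTM_subset_BQPQTMWith_adhAmplitudes_of_exec`, `QuantumTuringADHGateSet.lean`; both are
conditional reductions stated as the missing inclusion, and with
`BQPQTMWith_adhAmplitudes_subset_BQPQTM` they give this fact by `Set.Subset.antisymm`): a
well-formed QTM whose quantum transitions carry the gate entries `3/5, ±4/5` and whose classical
transitions carry `0, 1`, running a polynomial-time uniform family at a fixed polynomial time
(Nishimura–Ozawa 2002 Lemma 4.4 / Yao 1993; inside: BV 1997 §4 — a synchronous reversible
computation of the uniform description, i.e. of an arbitrary polynomial-time `TM2` function, on
one tape — and an oblivious head schedule applying the listed gates). It is the `adhAmplitudes`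
instance of the generic executor "`BQPOver G ⊆ BQPQTMWith S` for finite unitary `G` with entries
in `S ∋ 0, ±1`", whose Clifford+`T` instance is the remaining hypothesis `BQP ⊆ BQPQTM` of S04
(plan `Exec F` in the docstring of `BQPQTM_eq_BQP` above); no executor exists in the tree yet,
and this is now the ONLY missing ingredient of S05. ROUTE A (the printed machine-level line,
seat 0): `QuantumTuringADHProofs.lean` (the inclusion `⊆`, `BQPQTMWith_adhAmplitudes_subset_BQPQTM`;
the class-level glue `BQPQTMWith_adhAmplitudes_of hBoost hSim`, ADH §2.1; ADH Lemma 3.5 for `θ/2π`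
irrational and non-Liouville), `QuantumTuringADHAngle.lean` (`θ = arccos (3/5)`, `θ/2π` irrational;
Feldman's input open), `Cryptography/QuantumTuringMachinePrecision.lean` (ingredient (3), BV §3.4),
`Cryptography/QuantumTuringMachineUnidirection*.lean` (ingredient (1), BV Lemma 5.5, in the
positioned model), `Cryptography/QuantumTuringMachinePositioned*.lean` (Bernstein–Vazirani's own
model `QTM.PCfg`, `PIsWellFormed ↔ IsWellFormed`, classes `BQPQTMPosWith S`, `BQPQTMPos`, for which
Cor. 3.2 reads `BQPQTMPosWith adhAmplitudes = BQPQTMPos`, glue `BQPQTMPosWith_adhAmplitudes_eq_of`,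
`QuantumTuringADHPositionedGlue.lean`). [cite: AdlemanDeMarraisHuangSICOMP1997, Thm. 3.1 and Cor. 3.2 with Thm. 3.3(e)] -/
def BQPQTMWith_adhAmplitudes : Prop :=
  BQPQTMWith adhAmplitudes = BQPQTM

/- interim partial proof (harness21 @ d8f2665), preserved for route work:
:= by
  refine Set.Subset.antisymm
    (BQPQTMWith_mono adhAmplitudes_subset_polyTimeComputableComplex) ?_
  sorry
-/

end Literature.Computability.QuantumComplexity
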